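import Summits.ValiantsHypothesis.ValiantsHypothesis.Theorems.BarrierLeverAnchoredDoorHitsLowerPairsOnePeelBlocks
import Summits.ValiantsHypothesis.ValiantsHypothesis.Theorems.BarrierLeverAnchoredDoorHitsLowerPairsStarSpec
import Summits.ValiantsHypothesis.ValiantsHypothesis.Theorems.BarrierLeverAnchoredDoorHitsLowerPairsKernelLineBlocks
import Summits.ValiantsHypothesis.ValiantsHypothesis.Theorems.BarrierLeverAnchoredDoorHitsLowerPairsPairingTopCoeff
import Summits.ValiantsHypothesis.ValiantsHypothesis.Theorems.BarrierLeverAnchoredDoorHitsLowerPairsBase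

/-!
# Support item `AnchoredDoorHitsLowerPairs` (stmt-ValiantsHypothesis-22510), line `anchored-peeling`:
# THE GAP-ONE STEP — a vertex peel `a ↦ (a|c)` with link gap `ℓ_c = ℓ_a + 1` (kernel theorem; UQ_s-step with m = 1)

Helper file (`--supports stmt-ValiantsHypothesis-22510`; cell valiant-natproofs, rung V4, 𝒟-side door (c); registered line
`Cruxes/AnchoredDoorHitsLowerPairs/Lines/anchored_peeling.lean` v13 (composition `Stmt.stub_uqFaceStep → Stmt.stub_uqFaceResidual → crux`); prover seat
val-np-p1 gen 19; blueprint HOME/val-np-p1/g19/QSTEP-BLUEPRINT-valnp1-g19.md ADDENDUM 2). Closes NO item.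

THEOREM `symbolicDet_ne_zero_of_gapOne`. Let `(u, w)` be an injective layout, `a, c` vertices, and suppose the column family contains `∅`. Peel `a` onto `c`
(file `…OnePeel`): the peeled layout `G` has LINK rows `i` (`a ∈ u i`, faces `u i ∖ a`, entries `[x^{u i∖a} y^{w j∖c}]𝔄` at the columns through `c` and `0`
elsewhere) and DELETION rows (`a ∉ u i`, ordinary entries). Reindex the deletion-rows × `c`-free-columns block as a TALL `(n+1) × n` matrix and the
link-rows × `c`-columns block as a WIDE `n′ × (n′+1)` matrix (so `ℓ_c = ℓ_a + 1`: GAP ONE). If SOME maximal minor of each is a nonzero polynomial — these are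
symbolic minors of the deletion pair and of the link pair, the induction hypotheses (H1), (H2) of the skeleton — then `symbolicDet s h r u w ≠ 0`.

PROOF (modules M1, M2′, M3, M4 of the blueprint). `det G ≠ 0` suffices (`symbolicDet_ne_zero_of_peel_genDet`). Let `α`, `β` be the cofactor vectors of the two
blocks (`…KernelLineBlocks`), `A₀ = u i_A` and `B₀ = w j_B` faces that are ⊆-maximal in their supports (`exists_maximal_support`); `A₀ ≠ ∅` because the `∅`-column
of the tall block is the unit vector at the `∅`-row (`constantCoeff_symbolicWitness`). Pick `b ∈ A₀` and SPECIALISE the private anchor `β₀ = ({b},{c})`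
(`…StarSpec.specHom` with twist sets `A₀ ∖ b`, `B₀ ∖ c`): outside the deletion × `c`-columns block the entries become constants (`coeff_symbolicWitness_eq_rest`),
inside they have `T`-degree `≤ N = |A₀| + |B₀| − 1` with top coefficient `[A₀ ⊆ u i ∧ B₀ ⊆ w j] · L°[u i ∖ A₀, w j ∖ B₀]` (entry formula
`coeff_map_specHom_symbolicWitness`). By `det_ne_zero_of_minors` it remains to see that the cross value `Σ C αᵢ · G′ᵢⱼ · C βⱼ` is nonzero: its `T^N` coefficient
is the single term `α_{i_A} · L°[∅,∅] · β_{j_B} = α_{i_A} β_{j_B} ≠ 0` (`cross_top_ne_zero`).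

WHAT THIS IS NOT: not the registered stub itself (face targets `F`, general gap `m`, up-sets with distinct roots remain); nothing on crux
stmt-ValiantsHypothesis-14610 or on `VP` versus `VNP`.
-/

set_option linter.dupNamespace false

open Matrix

namespace Summit.ValiantsHypothesis.ValiantsHypothesis.Theorems.BarrierLever.AnchoredPeeling

open Finset MvPolynomial
open Summit.ValiantsHypothesis.ValiantsHypothesis.Theorems.BarrierLever.BrickCalculus (pexpo pexpo_def pexpo_le_iff pexpo_sub)

noncomputable section

/-! ## 1. Generic pieces -/

section Generic

variable {A B : Type*} [CommRing A] [CommRing B]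

/-- Two-sided entry shape `C c₀ + Σ_{Z ⊆ P} Σ_{W ⊆ Q} [cond Z W] · T^{|Z|+|W|+1} c Z W`: degree at most `|P| + |Q| + 1`. -/
theorem natDegree_entry₂_le {β γ : Type*} (c₀ : A) (P : Finset β) (Q : Finset γ) (cond : Finset β → Finset γ → Prop)
    [∀ Z W, Decidable (cond Z W)] (c : Finset β → Finset γ → A) :
    (Polynomial.C c₀ + ∑ Z ∈ P.powerset, ∑ W ∈ Q.powerset,
        (if cond Z W then Polynomial.monomial (Z.card + W.card + 1) (c Z W) else 0)).natDegree ≤ P.card + Q.card + 1 := by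
  refine (Polynomial.natDegree_add_le _ _).trans (max_le (by rw [Polynomial.natDegree_C]; exact Nat.zero_le _) ?_)
  refine Polynomial.natDegree_sum_le_of_forall_le _ _ (fun Z hZ => ?_)
  refine Polynomial.natDegree_sum_le_of_forall_le _ _ (fun W hW => ?_)
  have hZ' := Finset.card_le_card (Finset.mem_powerset.mp hZ)
  have hW' := Finset.card_le_card (Finset.mem_powerset.mp hW)
  split_ifs
  · exact (Polynomial.natDegree_monomial_le _).trans (by omega)
  · rw [Polynomial.natDegree_zero]; exact Nat.zero_le _

/-- Two-sided entry shape: the coefficient of `T^{|P|+|Q|+1}` is the `(P, Q)` term. -/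
theorem coeff_entry₂_top {β γ : Type*} (c₀ : A) (P : Finset β) (Q : Finset γ) (cond : Finset β → Finset γ → Prop)
    [∀ Z W, Decidable (cond Z W)] (c : Finset β → Finset γ → A) :
    (Polynomial.C c₀ + ∑ Z ∈ P.powerset, ∑ W ∈ Q.powerset,
        (if cond Z W then Polynomial.monomial (Z.card + W.card + 1) (c Z W) else 0)).coeff (P.card + Q.card + 1) =
      if cond P Q then c P Q else 0 := by
  rw [Polynomial.coeff_add, Polynomial.coeff_C, if_neg (Nat.succ_ne_zero _), zero_add, Polynomial.finsetSum_coeff]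
  -- only Z = P contributes
  rw [Finset.sum_eq_single P]
  · rw [Polynomial.finsetSum_coeff, Finset.sum_eq_single Q]
    · split_ifs
      · rw [Polynomial.coeff_monomial, if_pos rfl]
      · rw [Polynomial.coeff_zero]
    · intro W hW hWQ
      have hlt : W.card < Q.card := Finset.card_lt_card (lt_of_le_of_ne (Finset.mem_powerset.mp hW) hWQ)
      split_ifs
      · rw [Polynomial.coeff_monomial, if_neg (by omega)]
      · rw [Polynomial.coeff_zero]
    · intro hQ; exact absurd (Finset.mem_powerset.mpr subset_rfl) hQ
  · intro Z hZ hZP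
    have hlt : Z.card < P.card := Finset.card_lt_card (lt_of_le_of_ne (Finset.mem_powerset.mp hZ) hZP)
    rw [Polynomial.finsetSum_coeff]
    refine Finset.sum_eq_zero (fun W hW => ?_)
    have hW' := Finset.card_le_card (Finset.mem_powerset.mp hW)
    split_ifs
    · rw [Polynomial.coeff_monomial, if_neg (by omega)]
    · rw [Polynomial.coeff_zero]
  · intro hP; exact absurd (Finset.mem_powerset.mpr subset_rfl) hP

/-- Row cofactors commute with ring maps. -/
theorem rowCofactor_map {n : ℕ} (f : A →+* B) (M : Matrix (Fin (n + 1)) (Fin n) A) (x : Fin (n + 1)) :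
    Matrix.rowCofactor (M.map f) x = f (Matrix.rowCofactor M x) := by
  rw [rowCofactor_apply, rowCofactor_apply, map_mul, map_pow, map_neg, map_one, Matrix.submatrix_map, RingHom.map_det,
    RingHom.mapMatrix_apply]

/-- Column cofactors commute with ring maps. -/
theorem colCofactor_map {n : ℕ} (f : A →+* B) (M : Matrix (Fin n) (Fin (n + 1)) A) (y : Fin (n + 1)) :
    Matrix.colCofactor (M.map f) y = f (Matrix.colCofactor M y) := by
  rw [Matrix.colCofactor, Matrix.colCofactor, map_mul, map_pow, map_neg, map_one, Matrix.submatrix_map, RingHom.map_det,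
    RingHom.mapMatrix_apply]

/-- A dot product against a matrix–vector product as a double sum. -/
theorem dotProduct_mulVec_eq_sum_sum {m : Type*} [Fintype m] (x y : m → A) (S : Matrix m m A) :
    x ⬝ᵥ (S *ᵥ y) = ∑ i, ∑ j, x i * S i j * y j := by
  simp only [dotProduct, Matrix.mulVec, Finset.mul_sum, mul_assoc]

end Generic

/-! ## 2. The reduced layout has constant term one -/

variable {s h r : ℕ}

/-- The reduced witness (one anchor factor removed) has the entry `L°[∅, ∅] = 1`. -/
theorem restEntry_empty_empty (s h : ℕ) (αs : Finset (Fin h) × Finset (Fin h)) : restEntry s h αs ∅ ∅ = 1 := by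
  rw [restEntry, pexpo_def, Finset.sum_empty, Finset.sum_empty, add_zero, ← constantCoeff_eq, symbRest, map_prod]
  refine Finset.prod_eq_one (fun α hα => ?_)
  have hA : α.1.Nonempty := by
    have := (Finset.mem_erase.mp hα).2
    rw [anchors, Finset.mem_filter] at this
    exact Finset.card_pos.mp (by omega)
  obtain ⟨a, ha⟩ := hA
  have hX : constantCoeff (∏ a ∈ α.1, X (Fin.castAdd h a) : MvPolynomial (Fin (h + h)) (MvPolynomial (Param h) ℂ)) = 0 := by
    rw [map_prod]
    exact Finset.prod_eq_zero ha (constantCoeff_X _ _)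
  rw [symbFactor]
  simp only [map_add, map_one, map_mul, hX, mul_zero, zero_mul, add_zero]

/-! ## 3. The peeled layout and its specialised entries -/

/-- The one-peeled layout matrix at `(a, c)` (file `…OnePeel`): link rows `(u i ∖ a | {c})`, deletion rows `(u i | ∅)`. -/
abbrev peelMatrix (s h r : ℕ) (u w : Fin r → Finset (Fin h)) (a c : Fin h) :
    Matrix (Fin r) (Fin r) (MvPolynomial (Param h) ℂ) :=
  DTPeel.genMatrix s h r (DTPeel.onePeelU a u) (DTPeel.onePeelE a c u) w

variable (u w : Fin r → Finset (Fin h)) (a c : Fin h)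

/-- Link row, column avoiding `c`: zero. -/
theorem peelMatrix_link_of_not_mem {i j : Fin r} (hi : a ∈ u i) (hj : c ∉ w j) : peelMatrix s h r u w a c i j = 0 := by
  show DTPeel.genMatrix s h r _ _ w i j = 0
  rw [DTPeel.genMatrix, Matrix.of_apply]
  exact genEntry_onePeel_link_of_not_mem s u w a c hi hj

/-- Link row, column through `c`: the link-pair entry. -/
theorem peelMatrix_link_of_mem {i j : Fin r} (hi : a ∈ u i) (hj : c ∈ w j) :
    peelMatrix s h r u w a c i j = coeff (pexpo ((u i).erase a) ((w j).erase c)) (symbolicWitness s h) := by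
  show DTPeel.genMatrix s h r _ _ w i j = _
  rw [DTPeel.genMatrix, Matrix.of_apply]
  exact genEntry_onePeel_link_of_mem s u w a c hi hj

/-- Deletion row: the ordinary entry. -/
theorem peelMatrix_del {i : Fin r} (hi : a ∉ u i) (j : Fin r) :
    peelMatrix s h r u w a c i j = coeff (pexpo (u i) (w j)) (symbolicWitness s h) := by
  show DTPeel.genMatrix s h r _ _ w i j = _
  rw [DTPeel.genMatrix, Matrix.of_apply]
  exact genEntry_onePeel_del s u w a c j hi

variable {u w a c}

section Spec

variable {β₀ : Finset (Fin h) × Finset (Fin h)} {P Q : Finset (Fin h)}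

/-- Degree bound of a specialised entry. -/
theorem natDegree_specHom_coeff_le (hβ₀ : β₀ ∈ anchors s h) (hP : P ⊆ univ \ β₀.1) (hQ : Q ⊆ univ \ β₀.2)
    (S T : Finset (Fin h)) :
    (specHom β₀ P Q (coeff (pexpo S T) (symbolicWitness s h))).natDegree ≤ P.card + Q.card + 1 := by
  rw [← MvPolynomial.coeff_map, coeff_map_specHom_symbolicWitness s h hβ₀ hP hQ S T]
  exact natDegree_entry₂_le (restEntry s h β₀ S T) P Q (fun Z W => β₀.1 ∪ Z ⊆ S ∧ β₀.2 ∪ W ⊆ T)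
    (fun Z W => restEntry s h β₀ (S \ (β₀.1 ∪ Z)) (T \ (β₀.2 ∪ W)))

/-- Top coefficient of a specialised entry. -/
theorem coeff_specHom_coeff_top (hβ₀ : β₀ ∈ anchors s h) (hP : P ⊆ univ \ β₀.1) (hQ : Q ⊆ univ \ β₀.2)
    (S T : Finset (Fin h)) :
    (specHom β₀ P Q (coeff (pexpo S T) (symbolicWitness s h))).coeff (P.card + Q.card + 1) =
      if β₀.1 ∪ P ⊆ S ∧ β₀.2 ∪ Q ⊆ T then restEntry s h β₀ (S \ (β₀.1 ∪ P)) (T \ (β₀.2 ∪ Q)) else 0 := by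
  rw [← MvPolynomial.coeff_map, coeff_map_specHom_symbolicWitness s h hβ₀ hP hQ S T]
  exact coeff_entry₂_top (restEntry s h β₀ S T) P Q (fun Z W => β₀.1 ∪ Z ⊆ S ∧ β₀.2 ∪ W ⊆ T)
    (fun Z W => restEntry s h β₀ (S \ (β₀.1 ∪ Z)) (T \ (β₀.2 ∪ W)))

/-- Off the anchor's support a specialised entry is the constant original entry. -/
theorem specHom_coeff_eq_C (hβ₀ : β₀ ∈ anchors s h) (hP : P ⊆ univ \ β₀.1) (hQ : Q ⊆ univ \ β₀.2)
    (S T : Finset (Fin h)) (hnot : ¬ (β₀.1 ⊆ S ∧ β₀.2 ⊆ T)) :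
    specHom β₀ P Q (coeff (pexpo S T) (symbolicWitness s h)) = Polynomial.C (coeff (pexpo S T) (symbolicWitness s h)) := by
  rw [← MvPolynomial.coeff_map, coeff_map_specHom_symbolicWitness s h hβ₀ hP hQ S T, coeff_symbolicWitness_eq_rest s h hβ₀ S T hnot,
    Finset.sum_eq_zero (fun Z _ => ?_), add_zero]
  refine Finset.sum_eq_zero (fun W _ => ?_)
  rw [if_neg]
  exact fun hZW => hnot ⟨Finset.union_subset_left hZW.1, Finset.union_subset_left hZW.2⟩

end Spec

/-! ## 4. The gap-one theorem -/

/-- **THE GAP-ONE STEP.** See the module docstring. Hypotheses: `u, w` injective; the column family contains `∅`; reindexings of the deletion-rows ×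
`c`-free-columns block of the peeled layout as a tall `(n+1) × n` matrix and of the link-rows × `c`-columns block as a wide `n′ × (n′+1)` matrix; one nonzero
maximal minor of each (symbolic minors of the deletion pair and of the link pair). Conclusion: the symbolic minor of `(u, w)` is a nonzero polynomial. -/
theorem symbolicDet_ne_zero_of_gapOne (hs : 1 ≤ s) (hu : Function.Injective u) (hw : Function.Injective w)
    (hw0 : ∃ j, w j = ∅) {n n' : ℕ}
    (eA : {i : Fin r // ¬ (a ∈ u i)} ≃ Fin (n + 1)) (eQ : {j : Fin r // c ∉ w j} ≃ Fin n)
    (eP : {i : Fin r // a ∈ u i} ≃ Fin n') (eC : {j : Fin r // ¬ (c ∉ w j)} ≃ Fin (n' + 1))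
    (x₀ : Fin (n + 1))
    (H1 : ((tallBlock (peelMatrix s h r u w a c) (fun i => a ∈ u i) (fun j => c ∉ w j) eA eQ).submatrix x₀.succAbove id).det ≠ 0)
    (y₀ : Fin (n' + 1))
    (H2 : ((wideBlock (peelMatrix s h r u w a c) (fun i => a ∈ u i) (fun j => c ∉ w j) eP eC).submatrix id y₀.succAbove).det ≠ 0) :
    symbolicDet s h r u w ≠ 0 := by
  classical
  -- names
  let p : Fin r → Prop := fun i => a ∈ u i
  let q : Fin r → Prop := fun j => c ∉ w j
  let G : Matrix (Fin r) (Fin r) (MvPolynomial (Param h) ℂ) := peelMatrix s h r u w a c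
  let α : Fin r → MvPolynomial (Param h) ℂ := blockCofactorRow G p q eA eQ
  let β : Fin r → MvPolynomial (Param h) ℂ := blockCofactorCol G p q eP eC
  -- (A) the cofactor vectors are nonzero at the anchor coordinates
  have hα0 : α (eA.symm x₀).1 ≠ 0 := by
    show blockCofactorRow G p q eA eQ (eA.symm x₀).1 ≠ 0
    rw [blockCofactorRow_of_neg G p q eA eQ (eA.symm x₀).2]
    have e1 : eA ⟨(eA.symm x₀).1, (eA.symm x₀).2⟩ = x₀ := by simp
    rw [e1]
    exact (rowCofactor_ne_zero_iff _ _).mpr H1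
  have hβ0 : β (eC.symm y₀).1 ≠ 0 := by
    show blockCofactorCol G p q eP eC (eC.symm y₀).1 ≠ 0
    rw [blockCofactorCol_of_neg G p q eP eC (eC.symm y₀).2]
    have e1 : eC ⟨(eC.symm y₀).1, (eC.symm y₀).2⟩ = y₀ := by simp
    rw [e1, Matrix.colCofactor]
    exact mul_ne_zero (pow_ne_zero _ (by norm_num)) H2
  have hαne : α ≠ 0 := fun h0 => hα0 (by rw [h0]; rfl)
  have hβne : β ≠ 0 := fun h0 => hβ0 (by rw [h0]; rfl)
  -- (B) maximal support faces
  obtain ⟨i_A, hiA0, hiA⟩ := exists_maximal_support u hu α hαne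
  obtain ⟨j_B, hjB0, hjB⟩ := exists_maximal_support w hw β hβne
  have hiAp : a ∉ u i_A := fun hp => hiA0 (blockCofactorRow_of_pos G p q eA eQ hp)
  have hjBq : c ∈ w j_B := by
    by_contra hq
    exact hjB0 (blockCofactorCol_of_pos G p q eP eC hq)
  -- (C) the row face A₀ = u i_A is nonempty
  have hA₀ne : (u i_A).Nonempty := by
    by_contra hempty
    rw [Finset.not_nonempty_iff_eq_empty] at hempty
    obtain ⟨j₀, hj₀⟩ := hw0
    have hq₀ : q j₀ := by show c ∉ w j₀; rw [hj₀]; exact Finset.notMem_empty c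
    have hker := blockCofactorRow_vecMul_of_pos G p q eA eQ hq₀
    have hsupp : ∀ i, i ≠ i_A → α i = 0 := fun i hi => by
      by_contra hne
      exact hi (hiA i hne (by rw [hempty]; exact Finset.empty_subset _))
    have hsum : (α ᵥ* G) j₀ = α i_A * G i_A j₀ := by
      change ∑ i, α i * G i j₀ = _
      rw [Finset.sum_eq_single i_A (fun i _ hi => by rw [hsupp i hi, zero_mul]) (fun h' => (h' (Finset.mem_univ _)).elim)]
    have hG1 : G i_A j₀ = 1 := by
      show peelMatrix s h r u w a c i_A j₀ = 1
      rw [peelMatrix_del u w a c hiAp, hempty, hj₀, pexpo_def, Finset.sum_empty, Finset.sum_empty, add_zero, ← constantCoeff_eq,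
        constantCoeff_symbolicWitness]
    rw [hsum, hG1, mul_one] at hker
    exact hiA0 hker
  obtain ⟨b, hb⟩ := hA₀ne
  -- (D) the private anchor and its specialisation
  let β₀ : Finset (Fin h) × Finset (Fin h) := ({b}, {c})
  have hβ₀ : β₀ ∈ anchors s h := by
    rw [anchors, Finset.mem_filter]
    refine ⟨Finset.mem_univ _, ?_⟩
    simp only [β₀, Finset.card_singleton]
    omega
  let P : Finset (Fin h) := (u i_A).erase b
  let Q : Finset (Fin h) := (w j_B).erase c
  have hP : P ⊆ univ \ β₀.1 := by
    intro x hx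
    rw [Finset.mem_sdiff, Finset.mem_singleton]
    exact ⟨Finset.mem_univ _, (Finset.mem_erase.mp hx).1⟩
  have hQ : Q ⊆ univ \ β₀.2 := by
    intro x hx
    rw [Finset.mem_sdiff, Finset.mem_singleton]
    exact ⟨Finset.mem_univ _, (Finset.mem_erase.mp hx).1⟩
  have hAP : β₀.1 ∪ P = u i_A := by
    show {b} ∪ (u i_A).erase b = u i_A
    rw [← Finset.insert_eq, Finset.insert_erase hb]
  have hBQ : β₀.2 ∪ Q = w j_B := by
    show {c} ∪ (w j_B).erase c = w j_B
    rw [← Finset.insert_eq, Finset.insert_erase hjBq]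
  let N : ℕ := P.card + Q.card + 1
  let f := specHom β₀ P Q
  let G' : Matrix (Fin r) (Fin r) (Polynomial (MvPolynomial (Param h) ℂ)) := G.map f
  -- (E) entries of G': constants outside the deletion × c-columns block
  have hG'C : ∀ i j, ¬ (a ∉ u i ∧ c ∈ w j) → G' i j = Polynomial.C (G i j) := by
    intro i j hij
    show f (peelMatrix s h r u w a c i j) = Polynomial.C (peelMatrix s h r u w a c i j)
    by_cases hi : a ∈ u i
    · by_cases hj : c ∈ w j
      · rw [peelMatrix_link_of_mem u w a c hi hj]
        exact specHom_coeff_eq_C hβ₀ hP hQ _ _ (fun h2 => by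
          have := h2.2
          simp only [β₀, Finset.singleton_subset_iff, Finset.mem_erase] at this
          exact this.1 rfl)
      · rw [peelMatrix_link_of_not_mem u w a c hi hj, map_zero, map_zero]
    · have hj : c ∉ w j := fun hj => hij ⟨hi, hj⟩
      rw [peelMatrix_del u w a c hi j]
      exact specHom_coeff_eq_C hβ₀ hP hQ _ _ (fun h2 => hj (by
        have := h2.2
        simp only [β₀, Finset.singleton_subset_iff] at this
        exact this))
  -- top coefficients of all entries of G'
  have hG'top : ∀ i j, (G' i j).coeff N =
      if (a ∉ u i ∧ c ∈ w j) ∧ (u i_A ⊆ u i ∧ w j_B ⊆ w j) then restEntry s h β₀ (u i \ u i_A) (w j \ w j_B) else 0 := by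
    intro i j
    by_cases hij : a ∉ u i ∧ c ∈ w j
    · show (f (peelMatrix s h r u w a c i j)).coeff N = _
      rw [peelMatrix_del u w a c hij.1 j, coeff_specHom_coeff_top hβ₀ hP hQ, hAP, hBQ]
      by_cases h2 : u i_A ⊆ u i ∧ w j_B ⊆ w j
      · rw [if_pos h2, if_pos ⟨hij, h2⟩]
      · rw [if_neg h2, if_neg (fun h3 => h2 h3.2)]
    · rw [hG'C i j hij, Polynomial.coeff_C, if_neg (Nat.succ_ne_zero _), if_neg (fun h3 => hij h3.1)]
  -- (F) the blocks of G' are the constant images of the blocks of G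
  have htall : tallBlock G' p q eA eQ = (tallBlock G p q eA eQ).map Polynomial.C := by
    refine Matrix.ext (fun x y => ?_)
    show G' (eA.symm x).1 (eQ.symm y).1 = Polynomial.C (G (eA.symm x).1 (eQ.symm y).1)
    exact hG'C _ _ (fun h2 => (eQ.symm y).2 h2.2)
  have hwide : wideBlock G' p q eP eC = (wideBlock G p q eP eC).map Polynomial.C := by
    refine Matrix.ext (fun x y => ?_)
    show G' (eP.symm x).1 (eC.symm y).1 = Polynomial.C (G (eP.symm x).1 (eC.symm y).1)
    exact hG'C _ _ (fun h2 => h2.1 (eP.symm x).2)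
  have hαmap : blockCofactorRow G' p q eA eQ = fun i => Polynomial.C (α i) := by
    funext i
    by_cases hi : p i
    · rw [blockCofactorRow_of_pos G' p q eA eQ hi]
      show (0 : Polynomial _) = Polynomial.C (blockCofactorRow G p q eA eQ i)
      rw [blockCofactorRow_of_pos G p q eA eQ hi, map_zero]
    · rw [blockCofactorRow_of_neg G' p q eA eQ hi, htall, rowCofactor_map]
      show _ = Polynomial.C (blockCofactorRow G p q eA eQ i)
      rw [blockCofactorRow_of_neg G p q eA eQ hi]
  have hβmap : blockCofactorCol G' p q eP eC = fun j => Polynomial.C (β j) := by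
    funext j
    by_cases hj : q j
    · rw [blockCofactorCol_of_pos G' p q eP eC hj]
      show (0 : Polynomial _) = Polynomial.C (blockCofactorCol G p q eP eC j)
      rw [blockCofactorCol_of_pos G p q eP eC hj, map_zero]
    · rw [blockCofactorCol_of_neg G' p q eP eC hj, hwide, colCofactor_map]
      show _ = Polynomial.C (blockCofactorCol G p q eP eC j)
      rw [blockCofactorCol_of_neg G p q eP eC hj]
  -- (G) det G' ≠ 0 by the kernel-line bridge
  have hdetG' : G'.det ≠ 0 := by
    refine det_ne_zero_of_minors G' p q eA eQ eP eC (fun i j hi hj => ?_) x₀ ?_ y₀ ?_ ?_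
    · show f (peelMatrix s h r u w a c i j) = 0
      rw [peelMatrix_link_of_not_mem u w a c hi hj, map_zero]
    · rw [htall, Matrix.submatrix_map, ← RingHom.mapMatrix_apply, ← RingHom.map_det]
      exact fun h0 => H1 (Polynomial.C_eq_zero.mp h0)
    · rw [hwide, Matrix.submatrix_map, ← RingHom.mapMatrix_apply, ← RingHom.map_det]
      exact fun h0 => H2 (Polynomial.C_eq_zero.mp h0)
    · rw [hαmap, hβmap, dotProduct_mulVec_eq_sum_sum]
      refine cross_top_ne_zero u w (u i_A) (w j_B) α β (fun i j => G' i j) N (fun i j hij => ?_) i_A hiA j_B hjB ?_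
      · rw [hG'top, if_neg (fun h3 => hij h3.2)]
      · rw [hG'top, if_pos ⟨⟨hiAp, hjBq⟩, subset_rfl, subset_rfl⟩, Finset.sdiff_self, Finset.sdiff_self, restEntry_empty_empty,
          mul_one]
        exact mul_ne_zero hiA0 hjB0
  -- (H) conclude
  have hdetG : G.det ≠ 0 := by
    intro h0
    apply hdetG'
    show (G.map f).det = 0
    rw [← RingHom.mapMatrix_apply, ← RingHom.map_det, h0, map_zero]
  exact symbolicDet_ne_zero_of_peel_genDet hs u w a c hdetG

end

end Summit.ValiantsHypothesis.ValiantsHypothesis.Theorems.BarrierLever.AnchoredPeeling
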